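import Mathlib
import Summits.Ventures.PercRepro2.HCov
import Summits.Ventures.PercRepro2.RootLeafUPocketGraph
import Summits.Ventures.PercRepro2.RootLeafUPocketShare
import Summits.Ventures.PercRepro2.RootLeafUPocket3Graph

/-!
# The boundary-`{u, a₂, c}` pocket at `b`: the separated-type factorisations (blind cell PercRepro2,
p4 g18; S3 (G4-u) item (ae), proofs/P4-G18-PDTHRESHOLD.md §6; no definitions)

`P ∋ b` a pocket with terminal set `{u, a₂, c}` (RootLeafUPocket3Graph), `off` / `inn` its outside and
pocket parts.  On the world `PD = {u ↮ a₂, c ∉ K ∪ L}` no two terminals are joined, outside or in the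
pocket, and the pocket part alone decides where `b` is.  Six of the twelve factorisations of the
pocket (K) identity (paper §6) — the `PD`-world ones:

* `PD_eq`: `PD = {off ∈ PD} ∩ {inn ∈ sep}` — hence `D = D₀ · W_sep` (`prob_PD_eq`);
* `PD_bK_eq`: `PD ∩ {b ∈ K} = {off ∈ PD} ∩ {inn ∈ sep ∧ a₂ ~ b}` — `P(PD, bK) = D₀ · W[sep, b ~ a₂]`;
* `PD_bc_eq`: `PD ∩ {b ↔ c} = {off ∈ PD} ∩ {inn ∈ sep ∧ c ~ b}` — `P(PD, b ↔ c) = D₀ · W[sep, b ~ c]`;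
* `PD_oK_eq`, `PD_bL_eq`, `PD_bL_oK_eq` (`o ∉ P`): `o ∈ K` is the outside event `a₂ ↔ o`, `b ∈ L` the pocket event
  `u ~ b` — `P(PD, oK) = PD₀oK · W_sep`, `P(PD, bL) = D₀ · W[sep, u ~ b]`, `P(PD, bL, oK) = PD₀oK · W[sep, u ~ b]`;

with `sep = {ω' | u ↮ a₂ ∧ c ↮ a₂ ∧ c ↮ u in ω'}` the pocket event «the terminals are pairwise separated»,
the products by `Pocket.prob_off_inter_inn` (the pocket part and the outside part are independent).
-/

namespace Summit.Ventures.PercRepro2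

open UnionCluster

namespace RootLeafU

namespace Pocket3

variable {V : Type*} {E : Type*}

section Sep

variable {ends : E → Sym2 V} {P : Set V} {u a₂ c b : V} {off inn : Config E → Config E}

/-- Membership in `PD = {u ↮ a₂, c ∉ K ∪ L}`. -/
lemma mem_PDEvent_iff {ω : Config E} :
    ω ∈ PDEvent ends u a₂ c ↔ ¬ Conn ends ω u a₂ ∧ ¬ Conn ends ω c u ∧ ¬ Conn ends ω c a₂ := by
  simp only [PDEvent, Dtilde, inU, Set.mem_inter_iff, Set.mem_compl_iff, Set.mem_union, mem_connEvent,
    not_or]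

/-- With the terminals pairwise separated in the pocket part, a pocket join between two terminals is
trivial: `s ~ t` in `inn ω` forces `s = t`. -/
lemma eq_of_conn_inn_of_sep {ω : Config E}
    (hsep : ¬ Conn ends (inn ω) u a₂ ∧ ¬ Conn ends (inn ω) c a₂ ∧ ¬ Conn ends (inn ω) c u)
    {s t : V} (hs : s = u ∨ s = a₂ ∨ s = c) (ht : t = u ∨ t = a₂ ∨ t = c)
    (h : Conn ends (inn ω) s t) : s = t := by
  obtain ⟨h1, h2, h3⟩ := hsep
  rcases hs with rfl | rfl | rfl <;> rcases ht with rfl | rfl | rfl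
  · rfl
  · exact absurd h h1
  · exact absurd (conn_symm h) h3
  · exact absurd (conn_symm h) h1
  · rfl
  · exact absurd (conn_symm h) h2
  · exact absurd h h3
  · exact absurd h h2
  · rfl

/-- A terminal `x` that reaches no other terminal outside, with the terminals pairwise separated in the
pocket part, reaches a terminal `s` in the one-excursion sense only if `s = x`. -/
lemma eq_of_reach {ω : Config E}
    (hsep : ¬ Conn ends (inn ω) u a₂ ∧ ¬ Conn ends (inn ω) c a₂ ∧ ¬ Conn ends (inn ω) c u)
    {x : V} (hoffx : ∀ s, (s = u ∨ s = a₂ ∨ s = c) → Conn ends (off ω) x s → s = x)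
    {s : V} (hTs : s = u ∨ s = a₂ ∨ s = c)
    (hM : Conn ends (off ω) x s ∨ ∃ s' t', (s' = u ∨ s' = a₂ ∨ s' = c) ∧ (t' = u ∨ t' = a₂ ∨ t' = c) ∧
      Conn ends (off ω) x s' ∧ Conn ends (inn ω) s' t' ∧ Conn ends (off ω) t' s) : s = x := by
  rcases hM with h | ⟨s', t', hTs', hTt', hxs', hs't', ht's⟩
  · exact hoffx s hTs h
  · have e1 : s' = x := hoffx s' hTs' hxs'
    subst e1
    have e2 : s' = t' := eq_of_conn_inn_of_sep hsep hTs' hTt' hs't'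
    subst e2
    exact hoffx s hTs ht's

/-- **`PD` factorises**: `PD = {off ∈ PD} ∩ {inn ∈ sep}`. -/
theorem PD_eq (hP : ∀ e y z, ends e = s(y, z) → y ∈ P → z ∈ P ∨ z = u ∨ z = a₂ ∨ z = c)
    (hoff : (∀ ω e, e ∈ touches ends P → off ω e = false) ∧ (∀ ω e, e ∉ touches ends P → off ω e = ω e))
    (hinn : (∀ ω e, e ∈ touches ends P → inn ω e = ω e) ∧ (∀ ω e, e ∉ touches ends P → inn ω e = false))
    (hu : u ∉ P) (ha : a₂ ∉ P) (hc : c ∉ P) :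
    PDEvent ends u a₂ c = {ω : Config E | off ω ∈ PDEvent ends u a₂ c} ∩
      {ω : Config E | ¬ Conn ends (inn ω) u a₂ ∧ ¬ Conn ends (inn ω) c a₂ ∧ ¬ Conn ends (inn ω) c u} := by
  ext ω
  simp only [Set.mem_inter_iff, Set.mem_setOf_eq, mem_PDEvent_iff]
  constructor
  · rintro ⟨h1, h2, h3⟩
    exact ⟨⟨fun h => h1 (conn_mono (Pocket.off_le hoff ω) h), fun h => h2 (conn_mono (Pocket.off_le hoff ω) h),
        fun h => h3 (conn_mono (Pocket.off_le hoff ω) h)⟩,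
      fun h => h1 (conn_mono (Pocket.inn_le hinn ω) h), fun h => h3 (conn_mono (Pocket.inn_le hinn ω) h),
        fun h => h2 (conn_mono (Pocket.inn_le hinn ω) h)⟩
  · rintro ⟨⟨h1, h2, h3⟩, hsep⟩
    -- no connection between two terminals: outside it would be direct, and a pocket excursion is trivial
    have key : ∀ x y : V, x ∉ P → y ∉ P → ¬ Conn ends (off ω) x y → Conn ends ω x y → False := by
      intro x y hx hy hxy h
      rcases (conn_iff_off_or_excursion hP hoff hinn hx hy).1 h with h' | ⟨s, t, hTs, hTt, hxs, hst, hty⟩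
      · exact hxy h'
      · have e := eq_of_conn_inn_of_sep hsep hTs hTt hst
        subst e
        exact hxy (conn_trans hxs hty)
    exact ⟨fun h => key u a₂ hu ha h1 h, fun h => key c u hc hu h2 h, fun h => key c a₂ hc ha h3 h⟩

/-- On `PD`, `b ∈ K` is the pocket event `a₂ ~ b`. -/
theorem PD_bK_eq (hP : ∀ e y z, ends e = s(y, z) → y ∈ P → z ∈ P ∨ z = u ∨ z = a₂ ∨ z = c)
    (hoff : (∀ ω e, e ∈ touches ends P → off ω e = false) ∧ (∀ ω e, e ∉ touches ends P → off ω e = ω e))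
    (hinn : (∀ ω e, e ∈ touches ends P → inn ω e = ω e) ∧ (∀ ω e, e ∉ touches ends P → inn ω e = false))
    (hu : u ∉ P) (ha : a₂ ∉ P) (hc : c ∉ P) (hb : b ∈ P) :
    PDEvent ends u a₂ c ∩ connEvent ends a₂ b = {ω : Config E | off ω ∈ PDEvent ends u a₂ c} ∩
      {ω : Config E | (¬ Conn ends (inn ω) u a₂ ∧ ¬ Conn ends (inn ω) c a₂ ∧ ¬ Conn ends (inn ω) c u) ∧
        Conn ends (inn ω) a₂ b} := by
  ext ω
  have hPD := Set.ext_iff.1 (PD_eq hP hoff hinn hu ha hc) ω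
  simp only [Set.mem_inter_iff, Set.mem_setOf_eq, mem_connEvent] at hPD ⊢
  rw [hPD]
  simp only [mem_PDEvent_iff]
  constructor
  · rintro ⟨⟨⟨h1, h2, h3⟩, hsep⟩, hab⟩
    refine ⟨⟨h1, h2, h3⟩, hsep, ?_⟩
    obtain ⟨s, hTs, hM, hsb⟩ := (conn_pocket_iff hP hoff hinn ha hb).1 hab
    have hoffa : ∀ s, (s = u ∨ s = a₂ ∨ s = c) → Conn ends (off ω) a₂ s → s = a₂ := by
      intro s hs h
      rcases hs with rfl | rfl | rfl
      · exact absurd (conn_symm h) h1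
      · rfl
      · exact absurd (conn_symm h) h3
    have e := eq_of_reach hsep hoffa hTs hM
    subst e
    exact hsb
  · rintro ⟨⟨h1, h2, h3⟩, hsep, hab⟩
    exact ⟨⟨⟨h1, h2, h3⟩, hsep⟩, conn_mono (Pocket.inn_le hinn ω) hab⟩

/-- On `PD`, `b ↔ c` is the pocket event `c ~ b`. -/
theorem PD_bc_eq (hP : ∀ e y z, ends e = s(y, z) → y ∈ P → z ∈ P ∨ z = u ∨ z = a₂ ∨ z = c)
    (hoff : (∀ ω e, e ∈ touches ends P → off ω e = false) ∧ (∀ ω e, e ∉ touches ends P → off ω e = ω e))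
    (hinn : (∀ ω e, e ∈ touches ends P → inn ω e = ω e) ∧ (∀ ω e, e ∉ touches ends P → inn ω e = false))
    (hu : u ∉ P) (ha : a₂ ∉ P) (hc : c ∉ P) (hb : b ∈ P) :
    PDEvent ends u a₂ c ∩ connEvent ends c b = {ω : Config E | off ω ∈ PDEvent ends u a₂ c} ∩
      {ω : Config E | (¬ Conn ends (inn ω) u a₂ ∧ ¬ Conn ends (inn ω) c a₂ ∧ ¬ Conn ends (inn ω) c u) ∧
        Conn ends (inn ω) c b} := by
  ext ω
  have hPD := Set.ext_iff.1 (PD_eq hP hoff hinn hu ha hc) ω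
  simp only [Set.mem_inter_iff, Set.mem_setOf_eq, mem_connEvent] at hPD ⊢
  rw [hPD]
  simp only [mem_PDEvent_iff]
  constructor
  · rintro ⟨⟨⟨h1, h2, h3⟩, hsep⟩, hcb⟩
    refine ⟨⟨h1, h2, h3⟩, hsep, ?_⟩
    obtain ⟨s, hTs, hM, hsb⟩ := (conn_pocket_iff hP hoff hinn hc hb).1 hcb
    have hoffc : ∀ s, (s = u ∨ s = a₂ ∨ s = c) → Conn ends (off ω) c s → s = c := by
      intro s hs h
      rcases hs with rfl | rfl | rfl
      · exact absurd h h2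
      · exact absurd h h3
      · rfl
    have e := eq_of_reach hsep hoffc hTs hM
    subst e
    exact hsb
  · rintro ⟨⟨h1, h2, h3⟩, hsep, hcb⟩
    exact ⟨⟨⟨h1, h2, h3⟩, hsep⟩, conn_mono (Pocket.inn_le hinn ω) hcb⟩

/-- On `PD`, `o ∈ K` (for `o ∉ P`) is the outside event `a₂ ↔ o`. -/
theorem PD_oK_eq (hP : ∀ e y z, ends e = s(y, z) → y ∈ P → z ∈ P ∨ z = u ∨ z = a₂ ∨ z = c)
    (hoff : (∀ ω e, e ∈ touches ends P → off ω e = false) ∧ (∀ ω e, e ∉ touches ends P → off ω e = ω e))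
    (hinn : (∀ ω e, e ∈ touches ends P → inn ω e = ω e) ∧ (∀ ω e, e ∉ touches ends P → inn ω e = false))
    (hu : u ∉ P) (ha : a₂ ∉ P) (hc : c ∉ P) {o : V} (ho : o ∉ P) :
    PDEvent ends u a₂ c ∩ connEvent ends a₂ o =
      {ω : Config E | off ω ∈ PDEvent ends u a₂ c ∩ connEvent ends a₂ o} ∩
      {ω : Config E | ¬ Conn ends (inn ω) u a₂ ∧ ¬ Conn ends (inn ω) c a₂ ∧ ¬ Conn ends (inn ω) c u} := by
  ext ω
  have hPD := Set.ext_iff.1 (PD_eq hP hoff hinn hu ha hc) ω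
  simp only [Set.mem_inter_iff, Set.mem_setOf_eq, mem_connEvent] at hPD ⊢
  rw [hPD]
  constructor
  · rintro ⟨⟨hoffPD, hsep⟩, hao⟩
    refine ⟨⟨hoffPD, ?_⟩, hsep⟩
    rcases (conn_iff_off_or_excursion hP hoff hinn ha ho).1 hao with h | ⟨s, t, hTs, hTt, has, hst, hto⟩
    · exact h
    · have e := eq_of_conn_inn_of_sep hsep hTs hTt hst
      subst e
      exact conn_trans has hto
  · rintro ⟨⟨hoffPD, hao⟩, hsep⟩
    exact ⟨⟨hoffPD, hsep⟩, conn_mono (Pocket.off_le hoff ω) hao⟩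

/-- On `PD`, `b ∈ L` is the pocket event `u ~ b`. -/
theorem PD_bL_eq (hP : ∀ e y z, ends e = s(y, z) → y ∈ P → z ∈ P ∨ z = u ∨ z = a₂ ∨ z = c)
    (hoff : (∀ ω e, e ∈ touches ends P → off ω e = false) ∧ (∀ ω e, e ∉ touches ends P → off ω e = ω e))
    (hinn : (∀ ω e, e ∈ touches ends P → inn ω e = ω e) ∧ (∀ ω e, e ∉ touches ends P → inn ω e = false))
    (hu : u ∉ P) (ha : a₂ ∉ P) (hc : c ∉ P) (hb : b ∈ P) :
    PDEvent ends u a₂ c ∩ connEvent ends u b = {ω : Config E | off ω ∈ PDEvent ends u a₂ c} ∩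
      {ω : Config E | (¬ Conn ends (inn ω) u a₂ ∧ ¬ Conn ends (inn ω) c a₂ ∧ ¬ Conn ends (inn ω) c u) ∧
        Conn ends (inn ω) u b} := by
  ext ω
  have hPD := Set.ext_iff.1 (PD_eq hP hoff hinn hu ha hc) ω
  simp only [Set.mem_inter_iff, Set.mem_setOf_eq, mem_connEvent] at hPD ⊢
  rw [hPD]
  simp only [mem_PDEvent_iff]
  constructor
  · rintro ⟨⟨⟨h1, h2, h3⟩, hsep⟩, hub⟩
    refine ⟨⟨h1, h2, h3⟩, hsep, ?_⟩
    obtain ⟨s, hTs, hM, hsb⟩ := (conn_pocket_iff hP hoff hinn hu hb).1 hub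
    have hoffu : ∀ s, (s = u ∨ s = a₂ ∨ s = c) → Conn ends (off ω) u s → s = u := by
      intro s hs h
      rcases hs with rfl | rfl | rfl
      · rfl
      · exact absurd h h1
      · exact absurd (conn_symm h) h2
    have e := eq_of_reach hsep hoffu hTs hM
    subst e
    exact hsb
  · rintro ⟨⟨h1, h2, h3⟩, hsep, hub⟩
    exact ⟨⟨⟨h1, h2, h3⟩, hsep⟩, conn_mono (Pocket.inn_le hinn ω) hub⟩

/-- On `PD`, `{b ∈ L, o ∈ K}` is the outside event `a₂ ↔ o` times the pocket event `u ~ b`. -/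
theorem PD_bL_oK_eq (hP : ∀ e y z, ends e = s(y, z) → y ∈ P → z ∈ P ∨ z = u ∨ z = a₂ ∨ z = c)
    (hoff : (∀ ω e, e ∈ touches ends P → off ω e = false) ∧ (∀ ω e, e ∉ touches ends P → off ω e = ω e))
    (hinn : (∀ ω e, e ∈ touches ends P → inn ω e = ω e) ∧ (∀ ω e, e ∉ touches ends P → inn ω e = false))
    (hu : u ∉ P) (ha : a₂ ∉ P) (hc : c ∉ P) (hb : b ∈ P) {o : V} (ho : o ∉ P) :
    PDEvent ends u a₂ c ∩ (connEvent ends a₂ o ∩ connEvent ends u b) =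
      {ω : Config E | off ω ∈ PDEvent ends u a₂ c ∩ connEvent ends a₂ o} ∩
      {ω : Config E | (¬ Conn ends (inn ω) u a₂ ∧ ¬ Conn ends (inn ω) c a₂ ∧ ¬ Conn ends (inn ω) c u) ∧
        Conn ends (inn ω) u b} := by
  ext ω
  have h1 := Set.ext_iff.1 (PD_oK_eq hP hoff hinn hu ha hc ho) ω
  have h2 := Set.ext_iff.1 (PD_bL_eq hP hoff hinn hu ha hc hb) ω
  simp only [Set.mem_inter_iff, Set.mem_setOf_eq, mem_connEvent] at h1 h2 ⊢
  constructor
  · rintro ⟨hPD, hao, hub⟩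
    obtain ⟨⟨hoffPD, hoffao⟩, hsep⟩ := h1.1 ⟨hPD, hao⟩
    obtain ⟨_, _, hinnub⟩ := h2.1 ⟨hPD, hub⟩
    exact ⟨⟨hoffPD, hoffao⟩, hsep, hinnub⟩
  · rintro ⟨⟨hoffPD, hoffao⟩, hsep, hinnub⟩
    obtain ⟨hPD, hao⟩ := h1.2 ⟨⟨hoffPD, hoffao⟩, hsep⟩
    obtain ⟨_, hub⟩ := h2.2 ⟨hoffPD, hsep, hinnub⟩
    exact ⟨hPD, hao, hub⟩

end Sep

section Masses

variable {ends : E → Sym2 V} {P : Set V} {u a₂ c b : V} {off inn : Config E → Config E}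
variable [Fintype E] [DecidableEq E] {R : Type*} [CommRing R] (p : E → R)

/-- `D = D₀ · W_sep`. -/
theorem prob_PD_eq (hP : ∀ e y z, ends e = s(y, z) → y ∈ P → z ∈ P ∨ z = u ∨ z = a₂ ∨ z = c)
    (hoff : (∀ ω e, e ∈ touches ends P → off ω e = false) ∧ (∀ ω e, e ∉ touches ends P → off ω e = ω e))
    (hinn : (∀ ω e, e ∈ touches ends P → inn ω e = ω e) ∧ (∀ ω e, e ∉ touches ends P → inn ω e = false))
    (hu : u ∉ P) (ha : a₂ ∉ P) (hc : c ∉ P) :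
    prob p (PDEvent ends u a₂ c) = prob p {ω : Config E | off ω ∈ PDEvent ends u a₂ c} *
      prob p {ω : Config E | inn ω ∈ {ω' : Config E | ¬ Conn ends ω' u a₂ ∧ ¬ Conn ends ω' c a₂ ∧ ¬ Conn ends ω' c u}} := by
  conv_lhs => rw [PD_eq hP hoff hinn hu ha hc]
  exact Pocket.prob_off_inter_inn p hoff hinn (PDEvent ends u a₂ c)
    {ω' : Config E | ¬ Conn ends ω' u a₂ ∧ ¬ Conn ends ω' c a₂ ∧ ¬ Conn ends ω' c u}

/-- `P(PD, bK) = D₀ · W[sep, a₂ ~ b]`. -/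
theorem prob_PD_bK_eq (hP : ∀ e y z, ends e = s(y, z) → y ∈ P → z ∈ P ∨ z = u ∨ z = a₂ ∨ z = c)
    (hoff : (∀ ω e, e ∈ touches ends P → off ω e = false) ∧ (∀ ω e, e ∉ touches ends P → off ω e = ω e))
    (hinn : (∀ ω e, e ∈ touches ends P → inn ω e = ω e) ∧ (∀ ω e, e ∉ touches ends P → inn ω e = false))
    (hu : u ∉ P) (ha : a₂ ∉ P) (hc : c ∉ P) (hb : b ∈ P) :
    prob p (PDEvent ends u a₂ c ∩ connEvent ends a₂ b) = prob p {ω : Config E | off ω ∈ PDEvent ends u a₂ c} *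
      prob p {ω : Config E | inn ω ∈ {ω' : Config E | (¬ Conn ends ω' u a₂ ∧ ¬ Conn ends ω' c a₂ ∧ ¬ Conn ends ω' c u) ∧
        Conn ends ω' a₂ b}} := by
  conv_lhs => rw [PD_bK_eq hP hoff hinn hu ha hc hb]
  exact Pocket.prob_off_inter_inn p hoff hinn (PDEvent ends u a₂ c)
    {ω' : Config E | (¬ Conn ends ω' u a₂ ∧ ¬ Conn ends ω' c a₂ ∧ ¬ Conn ends ω' c u) ∧ Conn ends ω' a₂ b}

/-- `P(PD, b ↔ c) = D₀ · W[sep, c ~ b]`. -/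
theorem prob_PD_bc_eq (hP : ∀ e y z, ends e = s(y, z) → y ∈ P → z ∈ P ∨ z = u ∨ z = a₂ ∨ z = c)
    (hoff : (∀ ω e, e ∈ touches ends P → off ω e = false) ∧ (∀ ω e, e ∉ touches ends P → off ω e = ω e))
    (hinn : (∀ ω e, e ∈ touches ends P → inn ω e = ω e) ∧ (∀ ω e, e ∉ touches ends P → inn ω e = false))
    (hu : u ∉ P) (ha : a₂ ∉ P) (hc : c ∉ P) (hb : b ∈ P) :
    prob p (PDEvent ends u a₂ c ∩ connEvent ends c b) = prob p {ω : Config E | off ω ∈ PDEvent ends u a₂ c} *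
      prob p {ω : Config E | inn ω ∈ {ω' : Config E | (¬ Conn ends ω' u a₂ ∧ ¬ Conn ends ω' c a₂ ∧ ¬ Conn ends ω' c u) ∧
        Conn ends ω' c b}} := by
  conv_lhs => rw [PD_bc_eq hP hoff hinn hu ha hc hb]
  exact Pocket.prob_off_inter_inn p hoff hinn (PDEvent ends u a₂ c)
    {ω' : Config E | (¬ Conn ends ω' u a₂ ∧ ¬ Conn ends ω' c a₂ ∧ ¬ Conn ends ω' c u) ∧ Conn ends ω' c b}

/-- `P(PD, oK) = PD₀oK · W_sep`. -/
theorem prob_PD_oK_eq (hP : ∀ e y z, ends e = s(y, z) → y ∈ P → z ∈ P ∨ z = u ∨ z = a₂ ∨ z = c)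
    (hoff : (∀ ω e, e ∈ touches ends P → off ω e = false) ∧ (∀ ω e, e ∉ touches ends P → off ω e = ω e))
    (hinn : (∀ ω e, e ∈ touches ends P → inn ω e = ω e) ∧ (∀ ω e, e ∉ touches ends P → inn ω e = false))
    (hu : u ∉ P) (ha : a₂ ∉ P) (hc : c ∉ P) {o : V} (ho : o ∉ P) :
    prob p (PDEvent ends u a₂ c ∩ connEvent ends a₂ o) =
      prob p {ω : Config E | off ω ∈ PDEvent ends u a₂ c ∩ connEvent ends a₂ o} *
      prob p {ω : Config E | inn ω ∈ {ω' : Config E | ¬ Conn ends ω' u a₂ ∧ ¬ Conn ends ω' c a₂ ∧ ¬ Conn ends ω' c u}} := by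
  conv_lhs => rw [PD_oK_eq hP hoff hinn hu ha hc ho]
  exact Pocket.prob_off_inter_inn p hoff hinn (PDEvent ends u a₂ c ∩ connEvent ends a₂ o)
    {ω' : Config E | ¬ Conn ends ω' u a₂ ∧ ¬ Conn ends ω' c a₂ ∧ ¬ Conn ends ω' c u}

/-- `P(PD, bL) = D₀ · W[sep, u ~ b]`. -/
theorem prob_PD_bL_eq (hP : ∀ e y z, ends e = s(y, z) → y ∈ P → z ∈ P ∨ z = u ∨ z = a₂ ∨ z = c)
    (hoff : (∀ ω e, e ∈ touches ends P → off ω e = false) ∧ (∀ ω e, e ∉ touches ends P → off ω e = ω e))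
    (hinn : (∀ ω e, e ∈ touches ends P → inn ω e = ω e) ∧ (∀ ω e, e ∉ touches ends P → inn ω e = false))
    (hu : u ∉ P) (ha : a₂ ∉ P) (hc : c ∉ P) (hb : b ∈ P) :
    prob p (PDEvent ends u a₂ c ∩ connEvent ends u b) = prob p {ω : Config E | off ω ∈ PDEvent ends u a₂ c} *
      prob p {ω : Config E | inn ω ∈ {ω' : Config E | (¬ Conn ends ω' u a₂ ∧ ¬ Conn ends ω' c a₂ ∧ ¬ Conn ends ω' c u) ∧
        Conn ends ω' u b}} := by
  conv_lhs => rw [PD_bL_eq hP hoff hinn hu ha hc hb]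
  exact Pocket.prob_off_inter_inn p hoff hinn (PDEvent ends u a₂ c)
    {ω' : Config E | (¬ Conn ends ω' u a₂ ∧ ¬ Conn ends ω' c a₂ ∧ ¬ Conn ends ω' c u) ∧ Conn ends ω' u b}

/-- `P(PD, bL, oK) = PD₀oK · W[sep, u ~ b]`. -/
theorem prob_PD_bL_oK_eq (hP : ∀ e y z, ends e = s(y, z) → y ∈ P → z ∈ P ∨ z = u ∨ z = a₂ ∨ z = c)
    (hoff : (∀ ω e, e ∈ touches ends P → off ω e = false) ∧ (∀ ω e, e ∉ touches ends P → off ω e = ω e))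
    (hinn : (∀ ω e, e ∈ touches ends P → inn ω e = ω e) ∧ (∀ ω e, e ∉ touches ends P → inn ω e = false))
    (hu : u ∉ P) (ha : a₂ ∉ P) (hc : c ∉ P) (hb : b ∈ P) {o : V} (ho : o ∉ P) :
    prob p (PDEvent ends u a₂ c ∩ (connEvent ends a₂ o ∩ connEvent ends u b)) =
      prob p {ω : Config E | off ω ∈ PDEvent ends u a₂ c ∩ connEvent ends a₂ o} *
      prob p {ω : Config E | inn ω ∈ {ω' : Config E | (¬ Conn ends ω' u a₂ ∧ ¬ Conn ends ω' c a₂ ∧ ¬ Conn ends ω' c u) ∧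
        Conn ends ω' u b}} := by
  conv_lhs => rw [PD_bL_oK_eq hP hoff hinn hu ha hc hb ho]
  exact Pocket.prob_off_inter_inn p hoff hinn (PDEvent ends u a₂ c ∩ connEvent ends a₂ o)
    {ω' : Config E | (¬ Conn ends ω' u a₂ ∧ ¬ Conn ends ω' c a₂ ∧ ¬ Conn ends ω' c u) ∧ Conn ends ω' u b}

end Masses

end Pocket3

end RootLeafU

end Summit.Ventures.PercRepro2
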